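import Literature.NumberTheory.NumberFields.CyclicQuinticField2651K3Integers
import Mathlib.NumberTheory.NumberField.ClassNumber
import Mathlib.NumberTheory.NumberField.Discriminant.Defs
import Mathlib.LinearAlgebra.Matrix.SchurComplement
import Mathlib.Topology.Algebra.Polynomial
import Mathlib.Algebra.Algebra.Rat
import HarnessLib

/-!
# The cyclic quintic field of conductor `2651`, number `3`: real places, `d_K = 2651⁴`, the Minkowski bound

Third file on `K = CyclicQuintic2651K3.K`. Verbatim the first part of the tree's
`CyclicQuinticField241Primes.lean` for this field: the five real roots of `f` (isolating intervals of
width `10⁻⁸`), the real embeddings `emb k : θ ↦ r k`, `K` totally real; the integral basis of orbit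
sums (`intBasis`, from `integerEquiv`) with Gram matrix `2651·I - 530·J`, hence
**`d_K = 2651⁴ = 49389986895601`** and **`⌊M_K⌋ ≤ 269867`**. Everything is PROVED.

## References

* D. A. Marcus, *Number Fields*, 2nd ed. (2018), Ch. 2 and Ch. 5, Cor. 2 of Thm. 37. [folklore]
* T. Dokchitser, V. Dokchitser, J. Number Theory 131 (2011) 1833–1839, proof of Thm. 2. [DokchitserDokchitser2011RankModN]
-/

noncomputable section

open Polynomial NumberField

namespace Literature.NumberTheory.NumberFields

namespace CyclicQuintic2651K3

/-! ### The five real roots and the real embeddings; `K` is totally real -/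

/-- The real quintic function `p(x) = x ^ 5 - x ^ 4 - 1060 * x ^ 3 - 7741 * x ^ 2 + 106549 * x + 125531`. [folklore] -/
def preal (x : ℝ) : ℝ := x ^ 5 - x ^ 4 - 1060 * x ^ 3 - 7741 * x ^ 2 + 106549 * x + 125531

/-- `p` is continuous. [folklore] -/
theorem continuous_preal : Continuous preal := by unfold preal; fun_prop

/-- `f` has a real root in each of five intervals of width `10⁻⁸` around
`-21.255136460`, `-19.500385040`, `-1.103075190`, `7.840557990`, `35.018038680`.
[folklore] -/
theorem exists_roots_preal :
    (∃ r, r ∈ Set.Ioo (-2125513646 / 100000000 : ℝ) (-2125513645 / 100000000) ∧ preal r = 0) ∧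
    (∃ r, r ∈ Set.Ioo (-1950038504 / 100000000 : ℝ) (-1950038503 / 100000000) ∧ preal r = 0) ∧
    (∃ r, r ∈ Set.Ioo (-110307519 / 100000000 : ℝ) (-110307518 / 100000000) ∧ preal r = 0) ∧
    (∃ r, r ∈ Set.Ioo (784055799 / 100000000 : ℝ) (784055800 / 100000000) ∧ preal r = 0) ∧
    (∃ r, r ∈ Set.Ioo (3501803868 / 100000000 : ℝ) (3501803869 / 100000000) ∧ preal r = 0) := by
  refine ⟨?_, ?_, ?_, ?_, ?_⟩
  · have h := intermediate_value_Ioo (show (-2125513646 / 100000000 : ℝ) ≤ -2125513645 / 100000000 by norm_num)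
      continuous_preal.continuousOn
    have h0 : (0 : ℝ) ∈ Set.Ioo (preal (-2125513646 / 100000000)) (preal (-2125513645 / 100000000)) := by
      simp only [preal, Set.mem_Ioo]; norm_num
    obtain ⟨r, hr, hr0⟩ := h h0
    exact ⟨r, hr, hr0⟩
  · have h := intermediate_value_Ioo' (show (-1950038504 / 100000000 : ℝ) ≤ -1950038503 / 100000000 by norm_num)
      continuous_preal.continuousOn
    have h0 : (0 : ℝ) ∈ Set.Ioo (preal (-1950038503 / 100000000)) (preal (-1950038504 / 100000000)) := by
      simp only [preal, Set.mem_Ioo]; norm_num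
    obtain ⟨r, hr, hr0⟩ := h h0
    exact ⟨r, hr, hr0⟩
  · have h := intermediate_value_Ioo (show (-110307519 / 100000000 : ℝ) ≤ -110307518 / 100000000 by norm_num)
      continuous_preal.continuousOn
    have h0 : (0 : ℝ) ∈ Set.Ioo (preal (-110307519 / 100000000)) (preal (-110307518 / 100000000)) := by
      simp only [preal, Set.mem_Ioo]; norm_num
    obtain ⟨r, hr, hr0⟩ := h h0
    exact ⟨r, hr, hr0⟩
  · have h := intermediate_value_Ioo' (show (784055799 / 100000000 : ℝ) ≤ 784055800 / 100000000 by norm_num)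
      continuous_preal.continuousOn
    have h0 : (0 : ℝ) ∈ Set.Ioo (preal (784055800 / 100000000)) (preal (784055799 / 100000000)) := by
      simp only [preal, Set.mem_Ioo]; norm_num
    obtain ⟨r, hr, hr0⟩ := h h0
    exact ⟨r, hr, hr0⟩
  · have h := intermediate_value_Ioo (show (3501803868 / 100000000 : ℝ) ≤ 3501803869 / 100000000 by norm_num)
      continuous_preal.continuousOn
    have h0 : (0 : ℝ) ∈ Set.Ioo (preal (3501803868 / 100000000)) (preal (3501803869 / 100000000)) := by
      simp only [preal, Set.mem_Ioo]; norm_num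
    obtain ⟨r, hr, hr0⟩ := h h0
    exact ⟨r, hr, hr0⟩

/-- The root `r₀ ≈ -21.25514`. [folklore] -/
def r₀ : ℝ := Classical.choose exists_roots_preal.1
/-- The root `r₁ ≈ -19.50039`. [folklore] -/
def r₁ : ℝ := Classical.choose exists_roots_preal.2.1
/-- The root `r₂ ≈ -1.10308`. [folklore] -/
def r₂ : ℝ := Classical.choose exists_roots_preal.2.2.1
/-- The root `r₃ ≈ 7.84056`. [folklore] -/
def r₃ : ℝ := Classical.choose exists_roots_preal.2.2.2.1
/-- The root `r₄ ≈ 35.01804`. [folklore] -/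
def r₄ : ℝ := Classical.choose exists_roots_preal.2.2.2.2

/-- `r₀ ∈ (-21.25513646, -21.25513645)`, `p(r₀) = 0`. [folklore] -/
theorem r₀_spec : r₀ ∈ Set.Ioo (-2125513646 / 100000000 : ℝ) (-2125513645 / 100000000) ∧ preal r₀ = 0 :=
  Classical.choose_spec exists_roots_preal.1
/-- `r₁ ∈ (-19.50038504, -19.50038503)`, `p(r₁) = 0`. [folklore] -/
theorem r₁_spec : r₁ ∈ Set.Ioo (-1950038504 / 100000000 : ℝ) (-1950038503 / 100000000) ∧ preal r₁ = 0 :=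
  Classical.choose_spec exists_roots_preal.2.1
/-- `r₂ ∈ (-1.10307519, -1.10307518)`, `p(r₂) = 0`. [folklore] -/
theorem r₂_spec : r₂ ∈ Set.Ioo (-110307519 / 100000000 : ℝ) (-110307518 / 100000000) ∧ preal r₂ = 0 :=
  Classical.choose_spec exists_roots_preal.2.2.1
/-- `r₃ ∈ (7.84055799, 7.84055800)`, `p(r₃) = 0`. [folklore] -/
theorem r₃_spec : r₃ ∈ Set.Ioo (784055799 / 100000000 : ℝ) (784055800 / 100000000) ∧ preal r₃ = 0 :=
  Classical.choose_spec exists_roots_preal.2.2.2.1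
/-- `r₄ ∈ (35.01803868, 35.01803869)`, `p(r₄) = 0`. [folklore] -/
theorem r₄_spec : r₄ ∈ Set.Ioo (3501803868 / 100000000 : ℝ) (3501803869 / 100000000) ∧ preal r₄ = 0 :=
  Classical.choose_spec exists_roots_preal.2.2.2.2

/-- The five real roots as a family. [folklore] -/
def r : Fin 5 → ℝ := ![r₀, r₁, r₂, r₃, r₄]

/-- Each `r k` is a root of `p`. [folklore] -/
theorem preal_r (k : Fin 5) : preal (r k) = 0 := by
  fin_cases k
  exacts [r₀_spec.2, r₁_spec.2, r₂_spec.2, r₃_spec.2, r₄_spec.2]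

/-- The roots are pairwise distinct. [folklore] -/
theorem r_injective : Function.Injective r := by
  have h0 := r₀_spec.1; have h1 := r₁_spec.1; have h2 := r₂_spec.1; have h3 := r₃_spec.1
  have h4 := r₄_spec.1
  simp only [Set.mem_Ioo] at h0 h1 h2 h3 h4
  intro i j hij
  fin_cases i <;> fin_cases j <;> first | rfl | (exfalso; simp [r] at hij; linarith)

/-- `quinticPolyRat` evaluated in `ℝ` is `p`. [folklore] -/
theorem eval₂_quinticPolyRat_eq_preal (x : ℝ) : quinticPolyRat.eval₂ (algebraMap ℚ ℝ) x = preal x := by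
  rw [eval₂_map, quinticPoly]
  simp only [eval₂_add, eval₂_sub, eval₂_mul, eval₂_X_pow, eval₂_X, eval₂_ofNat, map_ofNat]
  rfl

/-- A real root of `p` is a root of `quinticPolyRat` under `ℚ → ℝ`. [folklore] -/
theorem eval₂_quinticPolyRat_real {x : ℝ} (hx : preal x = 0) :
    quinticPolyRat.eval₂ (algebraMap ℚ ℝ) x = 0 := by
  rw [eval₂_quinticPolyRat_eq_preal, hx]

/-- The explicit real polynomial `P ∈ ℝ[X]` with `P(x) = p(x)`. [folklore] -/
def Preal : ℝ[X] := X ^ 5 - X ^ 4 - 1060 * X ^ 3 - 7741 * X ^ 2 + 106549 * X + 125531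

/-- `P(x) = p(x)`. [folklore] -/
theorem eval_Preal (x : ℝ) : Preal.eval x = preal x := by
  simp only [Preal, preal, eval_add, eval_sub, eval_mul, eval_pow, eval_X, eval_ofNat]

/-- `deg P = 5`. [folklore] -/
theorem natDegree_Preal : Preal.natDegree = 5 := by
  unfold Preal; compute_degree!

/-- `P ≠ 0`. [folklore] -/
theorem Preal_ne_zero : Preal ≠ 0 := fun h => by
  have := natDegree_Preal; rw [h, natDegree_zero] at this; exact absurd this (by norm_num)

/-- **The five roots are all the real roots of `f`** (five distinct roots of a quintic).
(Verbatim the tree's `CyclicQuintic241.root_cases`.) [folklore] -/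
theorem root_cases {x : ℝ} (hx : preal x = 0) : x = r₀ ∨ x = r₁ ∨ x = r₂ ∨ x = r₃ ∨ x = r₄ := by
  classical
  have h0 := r₀_spec.1; have h1 := r₁_spec.1; have h2 := r₂_spec.1; have h3 := r₃_spec.1
  have h4 := r₄_spec.1
  simp only [Set.mem_Ioo] at h0 h1 h2 h3 h4
  set S : Finset ℝ := {r₀, r₁, r₂, r₃, r₄} with hS
  have hScard : S.card = 5 := by
    rw [hS, Finset.card_insert_of_notMem, Finset.card_insert_of_notMem,
      Finset.card_insert_of_notMem, Finset.card_insert_of_notMem, Finset.card_singleton]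
    · rw [Finset.mem_singleton]; linarith
    · simp only [Finset.mem_insert, Finset.mem_singleton, not_or]; constructor <;> linarith
    · simp only [Finset.mem_insert, Finset.mem_singleton, not_or]
      refine ⟨?_, ?_, ?_⟩ <;> linarith
    · simp only [Finset.mem_insert, Finset.mem_singleton, not_or]
      refine ⟨?_, ?_, ?_, ?_⟩ <;> linarith
  have hmem : ∀ y, preal y = 0 → y ∈ Preal.roots.toFinset := fun y hy => by
    rw [Multiset.mem_toFinset, mem_roots Preal_ne_zero, IsRoot.def, eval_Preal]; exact hy
  have hsub : S ⊆ Preal.roots.toFinset := by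
    intro y hy
    simp only [hS, Finset.mem_insert, Finset.mem_singleton] at hy
    rcases hy with rfl | rfl | rfl | rfl | rfl
    exacts [hmem _ r₀_spec.2, hmem _ r₁_spec.2, hmem _ r₂_spec.2, hmem _ r₃_spec.2,
      hmem _ r₄_spec.2]
  have hcard : Preal.roots.toFinset.card ≤ S.card := by
    rw [hScard, ← natDegree_Preal]
    exact (Multiset.toFinset_card_le _).trans (Polynomial.card_roots' _)
  have heq : S = Preal.roots.toFinset := Finset.eq_of_subset_of_card_le hsub hcard
  have hxS : x ∈ S := by rw [heq]; exact hmem x hx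
  simpa [hS] using hxS

/-- A ring homomorphism `K = ℚ(θ) → ℝ` is determined by the image of `θ`. [folklore] -/
theorem ringHom_real_ext {g h : K →+* ℝ} (hgh : g θ = h θ) : g = h := by
  have : (g.toRatAlgHom : K →ₐ[ℚ] ℝ) = h.toRatAlgHom := AdjoinRoot.algHom_ext (by exact hgh)
  have := congrArg (fun f : K →ₐ[ℚ] ℝ => (f : K →+* ℝ)) this
  simpa using this

/-- **The real embedding `emb k : K → ℝ`, `θ ↦ r k`.** [folklore] -/
def emb (k : Fin 5) : K →+* ℝ :=
  AdjoinRoot.lift (algebraMap ℚ ℝ) (r k) (eval₂_quinticPolyRat_real (preal_r k))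

/-- `emb k θ = r k`. [folklore] -/
@[simp] theorem emb_θ (k : Fin 5) : emb k θ = r k := AdjoinRoot.lift_root _

/-- The five real embeddings are pairwise distinct. [folklore] -/
theorem emb_injective : Function.Injective emb := fun i j hij =>
  r_injective (by rw [← emb_θ, ← emb_θ, hij])

/-- The real embeddings give real complex embeddings. [folklore] -/
theorem isReal_ofReal_comp_emb (k : Fin 5) :
    ComplexEmbedding.IsReal (Complex.ofRealHom.comp (emb k)) :=
  ComplexEmbedding.isReal_iff.mpr (RingHom.ext fun x => by
    simp [ComplexEmbedding.conjugate_coe_eq, Complex.conj_ofReal])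

/-- **`K` is totally real**: `r₂(K) = 0`. [folklore] -/
theorem nrComplexPlaces_eq_zero : InfinitePlace.nrComplexPlaces K = 0 := by
  classical
  have h5 : 5 ≤ InfinitePlace.nrRealPlaces K := by
    rw [← InfinitePlace.card_real_embeddings]
    let ι : Fin 5 → {φ : K →+* ℂ // ComplexEmbedding.IsReal φ} :=
      fun k => ⟨Complex.ofRealHom.comp (emb k), isReal_ofReal_comp_emb k⟩
    have hι : Function.Injective ι := by
      intro i j hij
      apply emb_injective
      have h := congrArg (fun φ : {φ : K →+* ℂ // ComplexEmbedding.IsReal φ} => φ.1) hij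
      exact RingHom.ext fun x => Complex.ofReal_injective (RingHom.congr_fun h x)
    simpa using Fintype.card_le_of_injective ι hι
  have h := InfinitePlace.card_add_two_mul_card_eq_rank K
  rw [finrank_K] at h
  omega
/-! ### The integral basis of orbit sums; `d_K = 2651⁴`; the Minkowski bound -/

/-- Coordinates on the order, as a `ℤ`-linear equivalence with `ℤ⁵`. [folklore] -/
def coordEquiv : R ≃ₗ[ℤ] (Fin 5 → ℤ) where
  toFun u := u.coef
  invFun v := ⟨v⟩
  map_add' _ _ := rfl
  map_smul' _ _ := rfl
  left_inv _ := rfl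
  right_inv _ := rfl

/-- The coordinate basis of the order. [folklore] -/
def basisP : Module.Basis (Fin 5) ℤ R := Module.Basis.ofEquivFun coordEquiv

/-- `basisP b = basis b`. [folklore] -/
theorem basisP_apply (b : Fin 5) : basisP b = TAlg.basis b := by
  classical
  rw [basisP, Module.Basis.coe_ofEquivFun]
  ext x
  show Pi.single (M := fun _ : Fin 5 => ℤ) b 1 x = _
  rw [TAlg.basis_coef, Pi.single_apply]

/-- **The integral basis of orbit sums** of `𝓞 K` (transport of `basisP` along `integerEquiv`).
[folklore] -/
def intBasis : Module.Basis (Fin 5) ℤ (𝓞 K) :=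
  basisP.map integerEquiv.toAddEquiv.toIntLinearEquiv

/-- `intBasis b = g b`. [folklore] -/
theorem coe_intBasis (b : Fin 5) : ((intBasis b : 𝓞 K) : K) = g b := by
  rw [intBasis, Module.Basis.map_apply, basisP_apply]
  exact coe_integerEquiv_basis b

/-- The Gram matrix of the trace form on the orbit sums is `2651·(1 + c r)` with `c ≡ -530/2651`,
`r ≡ 1`. [folklore] -/
theorem traceMatrix_eq :
    Algebra.traceMatrix ℚ (fun b => g b) =
      (2651 : ℚ) • (1 + Matrix.replicateCol (Fin 1) (fun _ : Fin 5 => (-530 / 2651 : ℚ)) *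
        Matrix.replicateRow (Fin 1) (fun _ : Fin 5 => (1 : ℚ))) := by
  ext i j
  rw [Algebra.traceMatrix_apply, Algebra.traceForm_apply, trace_g_mul]
  simp [Matrix.mul_apply, Matrix.one_apply]
  split_ifs <;> norm_num

/-- **`d_K = 2651⁴ = 49389986895601`.** [folklore] -/
theorem discr_eq : NumberField.discr K = 49389986895601 := by
  classical
  have h1 : (NumberField.discr K : ℚ) = Algebra.discr ℚ (fun b => g b) := by
    rw [← NumberField.discr_eq_discr K intBasis, ← eq_intCast (algebraMap ℤ ℚ),
      ← Algebra.discr_localizationLocalization ℤ (nonZeroDivisors ℤ) K intBasis]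
    congr 1
    ext k
    rw [Module.Basis.localizationLocalization_apply, ← coe_intBasis k]
  have h2 : Algebra.discr ℚ (fun b => g b) = 49389986895601 := by
    rw [Algebra.discr_def, traceMatrix_eq, Matrix.det_smul, Matrix.det_one_add_mul_comm,
      Matrix.det_unique, Fintype.card_fin]
    simp [Matrix.mul_apply]
    norm_num
  exact_mod_cast h1.trans h2

/-- `|d_K| = 2651⁴`. [folklore] -/
theorem abs_discr_eq : |NumberField.discr K| = 49389986895601 := by
  rw [discr_eq]; rfl

/-- **`⌊M_K⌋ ≤ 269867`**: `M_K = (4/π)⁰ · (5!/5⁵) · √(2651⁴) = 120 · 7027801 / 3125 = 269867.5584`.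
[folklore] -/
theorem floor_minkowskiBound_le :
    ⌊(4 / Real.pi) ^ InfinitePlace.nrComplexPlaces K *
        ((Module.finrank ℚ K).factorial / (Module.finrank ℚ K : ℝ) ^ Module.finrank ℚ K *
          Real.sqrt |(NumberField.discr K : ℝ)|)⌋₊ ≤ 269867 := by
  have hsqrt : Real.sqrt |(NumberField.discr K : ℝ)| = 7027801 := by
    have h : |(NumberField.discr K : ℝ)| = 49389986895601 := by exact_mod_cast abs_discr_eq
    rw [h, show (49389986895601 : ℝ) = 7027801 ^ 2 by norm_num, Real.sqrt_sq (by norm_num)]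
  rw [nrComplexPlaces_eq_zero, finrank_K, hsqrt, pow_zero, one_mul]
  have hfac : ((5 : ℕ).factorial : ℝ) = 120 := by norm_num [Nat.factorial]
  rw [hfac]
  refine Nat.le_of_lt_succ ((Nat.floor_lt (by positivity)).mpr ?_)
  norm_num

end CyclicQuintic2651K3

end Literature.NumberTheory.NumberFields

end
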